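import Summits.Ventures.PercRepro2.CaseOneGadgetUWOPolyT

/-!
# The gadget `u ~ {w, o}`, `w ~ {u, a₁, a₂, b}` (uwo): the parts of the T-pair masses
(blind cell PercRepro2, p1 g32; the first stage of the gadget pipeline for the T-forms of the uwo gadget)

`sgOT` and `sgOTo` are multilinear in the three edge weights `e₀, e₁, e₂` (`u–w`, `u–o`, `w–a₁`); their parts
`pgOT_abc` / `pgOTo_abc` are polynomials in `e₃, e₄` (`w–a₂`, `w–b`) and the cells (**`sgOT_parts`**,
**`sgOTo_parts`**, the shape of `sgOQ_parts`). Own code; standard axioms. (Re-emitted comment-only at 12:5xZ to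
unstick the module's olean on the farm — the declarations are byte-identical to p633441.) -/

namespace Summit.Ventures.PercRepro2

namespace CaseOne

section PartsTO5
variable {R : Type*} [CommRing R]

/-- The `e₀^0 e₁^1 e₂^0` part of the mass `T`. -/
def pgOT010 (e₃ e₄ : R) (m : SCells R) : R :=
  (1 : R) * e₃ * e₄ * m.c10 + (-1 : R) * e₃ * e₄ * m.c7 + (1 : R) * m.c8 + (1 : R) * m.c7 + (1 : R) * m.c6

/-- The `e₀^0 e₁^1 e₂^1` part of the mass `T`. -/
def pgOT011 (e₃ e₄ : R) (m : SCells R) : R :=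
  (-1 : R) * e₃ * e₄ * m.c10 + (1 : R) * e₃ * e₄ * m.c8 + (1 : R) * e₃ * e₄ * m.c7 + (-1 : R) * e₃ * m.c8 + (-1 : R) * e₃ * m.c7 + (-1 : R) * e₃ * m.c6 + (-1 : R) * e₄ * m.c8

/-- The `e₀^1 e₁^0 e₂^0` part of the mass `T`. -/
def pgOT100 (e₃ e₄ : R) (m : SCells R) : R :=
  (-1 : R) * e₃ * e₄ * m.c8 + (-1 : R) * e₃ * e₄ * m.c7 + (-1 : R) * e₃ * e₄ * m.c5 + (-1 : R) * e₃ * e₄ * m.c4 + (-1 : R) * e₃ * e₄ * m.c2 + (-1 : R) * e₃ * e₄ * m.c1 + (1 : R) * e₃ * m.c10 + (1 : R) * e₃ * m.c9 + (1 : R) * e₃ * m.c8 + (1 : R) * e₃ * m.c7 + (1 : R) * e₃ * m.c6 + (1 : R) * e₃ * m.c5 + (1 : R) * e₃ * m.c4 + (1 : R) * e₃ * m.c3 + (1 : R) * e₃ * m.c2 + (1 : R) * e₃ * m.c1 + (1 : R) * e₄ * m.c8 + (1 : R) * e₄ * m.c5 + (1 : R) * e₄ * m.c2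

/-- The `e₀^1 e₁^0 e₂^1` part of the mass `T`. -/
def pgOT101 (e₃ e₄ : R) (m : SCells R) : R :=
  (1 : R) * e₃ * e₄ * m.c8 + (1 : R) * e₃ * e₄ * m.c7 + (1 : R) * e₃ * e₄ * m.c5 + (1 : R) * e₃ * e₄ * m.c4 + (1 : R) * e₃ * e₄ * m.c2 + (1 : R) * e₃ * e₄ * m.c1 + (-1 : R) * e₃ * m.c10 + (-1 : R) * e₃ * m.c9 + (-1 : R) * e₃ * m.c8 + (-1 : R) * e₃ * m.c7 + (-1 : R) * e₃ * m.c6 + (-1 : R) * e₃ * m.c5 + (-1 : R) * e₃ * m.c4 + (-1 : R) * e₃ * m.c3 + (-1 : R) * e₃ * m.c2 + (-1 : R) * e₃ * m.c1 + (-1 : R) * e₄ * m.c8 + (-1 : R) * e₄ * m.c5 + (-1 : R) * e₄ * m.c2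

/-- The `e₀^1 e₁^1 e₂^0` part of the mass `T`. -/
def pgOT110 (e₃ e₄ : R) (m : SCells R) : R :=
  (-1 : R) * e₃ * e₄ * m.c10 + (1 : R) * e₃ * e₄ * m.c8 + (2 : R) * e₃ * e₄ * m.c7 + (1 : R) * e₃ * e₄ * m.c5 + (1 : R) * e₃ * e₄ * m.c4 + (-1 : R) * e₃ * m.c8 + (-1 : R) * e₃ * m.c7 + (-1 : R) * e₃ * m.c6 + (-1 : R) * e₃ * m.c5 + (-1 : R) * e₃ * m.c4 + (-1 : R) * e₃ * m.c3 + (-1 : R) * e₄ * m.c8 + (-1 : R) * e₄ * m.c7 + (-1 : R) * e₄ * m.c5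

/-- The `e₀^1 e₁^1 e₂^1` part of the mass `T`. -/
def pgOT111 (e₃ e₄ : R) (m : SCells R) : R :=
  (1 : R) * e₃ * e₄ * m.c10 + (-2 : R) * e₃ * e₄ * m.c8 + (-2 : R) * e₃ * e₄ * m.c7 + (-1 : R) * e₃ * e₄ * m.c5 + (-1 : R) * e₃ * e₄ * m.c4 + (2 : R) * e₃ * m.c8 + (2 : R) * e₃ * m.c7 + (2 : R) * e₃ * m.c6 + (1 : R) * e₃ * m.c5 + (1 : R) * e₃ * m.c4 + (1 : R) * e₃ * m.c3 + (2 : R) * e₄ * m.c8 + (1 : R) * e₄ * m.c7 + (1 : R) * e₄ * m.c5 + (-1 : R) * m.c8 + (-1 : R) * m.c7 + (-1 : R) * m.c6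

/-- The mass `T` is multilinear in `e₀, e₁, e₂`: its parts. -/
lemma sgOT_parts (e₀ e₁ e₂ e₃ e₄ : R) (m : SCells R) :
    sgOT e₀ e₁ e₂ e₃ e₄ m = e₁ * pgOT010 e₃ e₄ m + e₁ * e₂ * pgOT011 e₃ e₄ m + e₀ * pgOT100 e₃ e₄ m + e₀ * e₂ * pgOT101 e₃ e₄ m + e₀ * e₁ * pgOT110 e₃ e₄ m + e₀ * e₁ * e₂ * pgOT111 e₃ e₄ m := by
  unfold sgOT pgOT010 pgOT011 pgOT100 pgOT101 pgOT110 pgOT111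
  ring

/-- The `e₀^0 e₁^1 e₂^0` part of the mass `To`. -/
def pgOTo010 (e₃ e₄ : R) (m : SCells R) : R :=
  (1 : R) * e₃ * e₄ * m.c10 + (-1 : R) * e₃ * e₄ * m.c7 + (1 : R) * m.c8 + (1 : R) * m.c7 + (1 : R) * m.c6

/-- The `e₀^0 e₁^1 e₂^1` part of the mass `To`. -/
def pgOTo011 (e₃ e₄ : R) (m : SCells R) : R :=
  (-1 : R) * e₃ * e₄ * m.c10 + (1 : R) * e₃ * e₄ * m.c8 + (1 : R) * e₃ * e₄ * m.c7 + (-1 : R) * e₃ * m.c8 + (-1 : R) * e₃ * m.c7 + (-1 : R) * e₃ * m.c6 + (-1 : R) * e₄ * m.c8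

/-- The `e₀^1 e₁^0 e₂^0` part of the mass `To`. -/
def pgOTo100 (e₃ e₄ : R) (m : SCells R) : R :=
  (1 : R) * e₃ * e₄ * m.c10 + (-1 : R) * e₃ * e₄ * m.c8 + (-1 : R) * e₃ * e₄ * m.c7 + (-1 : R) * e₃ * e₄ * m.c5 + (-1 : R) * e₃ * e₄ * m.c4 + (1 : R) * e₃ * m.c8 + (1 : R) * e₃ * m.c7 + (1 : R) * e₃ * m.c6 + (1 : R) * e₃ * m.c5 + (1 : R) * e₃ * m.c4 + (1 : R) * e₃ * m.c3 + (1 : R) * e₄ * m.c8 + (1 : R) * e₄ * m.c5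

/-- The `e₀^1 e₁^0 e₂^1` part of the mass `To`. -/
def pgOTo101 (e₃ e₄ : R) (m : SCells R) : R :=
  (-1 : R) * e₃ * e₄ * m.c10 + (1 : R) * e₃ * e₄ * m.c8 + (1 : R) * e₃ * e₄ * m.c7 + (1 : R) * e₃ * e₄ * m.c5 + (1 : R) * e₃ * e₄ * m.c4 + (-1 : R) * e₃ * m.c8 + (-1 : R) * e₃ * m.c7 + (-1 : R) * e₃ * m.c6 + (-1 : R) * e₃ * m.c5 + (-1 : R) * e₃ * m.c4 + (-1 : R) * e₃ * m.c3 + (-1 : R) * e₄ * m.c8 + (-1 : R) * e₄ * m.c5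

/-- The `e₀^1 e₁^1 e₂^0` part of the mass `To`. -/
def pgOTo110 (e₃ e₄ : R) (m : SCells R) : R :=
  (-2 : R) * e₃ * e₄ * m.c10 + (1 : R) * e₃ * e₄ * m.c8 + (2 : R) * e₃ * e₄ * m.c7 + (1 : R) * e₃ * e₄ * m.c5 + (1 : R) * e₃ * e₄ * m.c4 + (-1 : R) * e₃ * e₄ * m.c2 + (-1 : R) * e₃ * e₄ * m.c1 + (1 : R) * e₃ * m.c10 + (1 : R) * e₃ * m.c9 + (-1 : R) * e₃ * m.c8 + (-1 : R) * e₃ * m.c7 + (-1 : R) * e₃ * m.c6 + (-1 : R) * e₃ * m.c5 + (-1 : R) * e₃ * m.c4 + (-1 : R) * e₃ * m.c3 + (1 : R) * e₃ * m.c2 + (1 : R) * e₃ * m.c1 + (-1 : R) * e₄ * m.c8 + (-1 : R) * e₄ * m.c7 + (-1 : R) * e₄ * m.c5 + (1 : R) * e₄ * m.c2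

/-- The `e₀^1 e₁^1 e₂^1` part of the mass `To`. -/
def pgOTo111 (e₃ e₄ : R) (m : SCells R) : R :=
  (2 : R) * e₃ * e₄ * m.c10 + (-2 : R) * e₃ * e₄ * m.c8 + (-2 : R) * e₃ * e₄ * m.c7 + (-1 : R) * e₃ * e₄ * m.c5 + (-1 : R) * e₃ * e₄ * m.c4 + (1 : R) * e₃ * e₄ * m.c2 + (1 : R) * e₃ * e₄ * m.c1 + (-1 : R) * e₃ * m.c10 + (-1 : R) * e₃ * m.c9 + (2 : R) * e₃ * m.c8 + (2 : R) * e₃ * m.c7 + (2 : R) * e₃ * m.c6 + (1 : R) * e₃ * m.c5 + (1 : R) * e₃ * m.c4 + (1 : R) * e₃ * m.c3 + (-1 : R) * e₃ * m.c2 + (-1 : R) * e₃ * m.c1 + (2 : R) * e₄ * m.c8 + (1 : R) * e₄ * m.c7 + (1 : R) * e₄ * m.c5 + (-1 : R) * e₄ * m.c2 + (-1 : R) * m.c8 + (-1 : R) * m.c7 + (-1 : R) * m.c6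

/-- The mass `To` is multilinear in `e₀, e₁, e₂`: its parts. -/
lemma sgOTo_parts (e₀ e₁ e₂ e₃ e₄ : R) (m : SCells R) :
    sgOTo e₀ e₁ e₂ e₃ e₄ m = e₁ * pgOTo010 e₃ e₄ m + e₁ * e₂ * pgOTo011 e₃ e₄ m + e₀ * pgOTo100 e₃ e₄ m + e₀ * e₂ * pgOTo101 e₃ e₄ m + e₀ * e₁ * pgOTo110 e₃ e₄ m + e₀ * e₁ * e₂ * pgOTo111 e₃ e₄ m := by
  unfold sgOTo pgOTo010 pgOTo011 pgOTo100 pgOTo101 pgOTo110 pgOTo111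
  ring

end PartsTO5

end CaseOne

end Summit.Ventures.PercRepro2
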